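import Mathlib
import HarnessLib

/-!
# Support [1, p−1] plus unimodular coefficients carry only exponent 1/2 (the Legendre symbol is
load-bearing in FeketeNoSparseSplit)

Topic `Literature/Barriers/ValiantsHypothesis` (librarian move 2026-08-16 of the gate-parked module
`Literature/Uncategorized/FeketeNoSparseSplitWithoutLegendre.lean` — accept-time relocation of
propositions written inline in a `Summits/` proposal, human ruling 2026-08-15 — to the directory of
its mathematics; declarations byte-identical, only the namespace, this directory's, is new; the old
names remain behind as deprecated aliases).

out of the refuter proposal `Summits/ValiantsHypothesis/ValiantsHypothesis/Theorems/FeketeNoSparseSplit/Negative/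
FalseWithoutLegendre.lean` (cdisprove seat of crux stmt-ValiantsHypothesis-3997), which had written the refuted
VARIANT of the crux as a `[folklore]`-tagged `def … : Prop` inline; the relocation filed it as a "named literature
fact" (net debt +1).  It is NOT a fact: it is FALSE, and this revision (same declaration name and body) adds its
refutation `not_feketeNoSparseSplitWithoutLegendre` with the complete elementary proof, so the tree audit reads the
pair as `refutes`, not as trust base.

* `Literature.Barriers.ValiantsHypothesis.FeketeNoSparseSplitWithoutLegendre` — the crux `FeketeSOS.FeketeNoSparseSplit`
  (`∃ δ>0 ∃ p₀ ∀ primes p ≥ p₀ ∀ A B, A·B = F_p → p^{1/2+δ} ≤ |supp A| + |supp B|`) with the Legendre symbol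
  replaced by an ARBITRARY unimodular sequence `ε` on `[1, p-1]`.  FALSE.
* `Literature.Barriers.ValiantsHypothesis.not_feketeNoSparseSplitWithoutLegendre : ¬ FeketeNoSparseSplitWithoutLegendre` —
  witness for every prime `p`, `n = p-1`, `a = ⌊√n⌋+1`, `t = ⌊n/a⌋`, `ω = e^{2πi/3}`:
  `X·(1+X+⋯+X^{a-1}) · (Σ_{j<t} X^{aj} + ω X^{n-a})` has support exactly `[1, p-1]`, coefficients in `{1, 1+ω, ω}`
  (all of modulus `1`) and support-sum `≤ a + t + 1 ≤ 2√p + 2 < p^{1/2+δ}` once `p^δ ≥ 4`.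
  MEANING for the crux: "support `[1,p-1]` + unimodular coefficients + `p` prime" carries only the counting
  exponent `1/2`; any proof must use the arithmetic of the values `χ_p(m)` (the line `cyclic-valuation-dichotomy`
  does, through Euler's criterion mod `p`).
* `coeff_unimodularModel`, `sub_one_le_card_support_mul_card_support`, `two_mul_sqrt_le_card_support_add`,
  `feketeNoSparseSplitWithoutLegendre_delta_zero`, `feketeNoSparseSplitWithoutLegendre_endpoint` (appended
  2026-08-16 by the provefact seat that was asked for the impossible `_holds`) — the TRUE counterpart, PROVED:
  with the clause `0 < δ` deleted (exponent exactly `1/2`, threshold `p₀ = 2`, every `p`, every nowhere-zero `ε`)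
  the statement holds by counting: `supp (A·B) ⊆ supp A + supp B` gives `p - 1 ≤ |supp A|·|supp B|`, hence
  `|supp A| + |supp B| ≥ 2√(p-1) ≥ √p`.  So the refutation's support-sum `2√p + 2` is sharp up to the additive
  constant, and `0 < δ` is exactly the part of the refuted variant that fails.

LIBRARIAN (D-0022 sweep): the only intended user is
`Summits/ValiantsHypothesis/ValiantsHypothesis/Theorems/FeketeNoSparseSplit/Negative/FalseWithoutLegendre.lean`
(a one-line re-export under the crux's Negative/ lane); suggested home: fold the pair into that file, or into a
`Literature/NumberTheory/LFunctions/FeketePolynomialSplittings.lean` next to `feketePolynomial`; nothing here is a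
citable published statement (digit tilings of intervals are de Bruijn 1956 folklore).
-/

namespace Literature.Barriers.ValiantsHypothesis

open Polynomial Finset

/-- **FALSE — a refuted variant, see `not_feketeNoSparseSplitWithoutLegendre` below.**  The crux
`FeketeSOS.FeketeNoSparseSplit` with the Legendre symbol replaced by an ARBITRARY unimodular coefficient sequence
`ε` on `[1, p-1]` (same support `[1,p-1]`, same prime lengths, same exponent claim `1/2 + δ`); `χ_p` is one such
`ε`, so this formally strengthens the crux.  Kept under this name only because the gate relocated it here
(p74092); it is not a literature fact and nothing may assume it. [folklore] -/
def FeketeNoSparseSplitWithoutLegendre : Prop :=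
  ∃ δ : ℝ, 0 < δ ∧ ∃ p₀ : ℕ, ∀ (p : ℕ) [Fact p.Prime], p₀ ≤ p → ∀ (ε : ℕ → ℂ), (∀ m, ‖ε m‖ = 1) →
    ∀ (A B : Polynomial ℂ), A * B = ∑ m ∈ Finset.range p, C (if m = 0 then 0 else ε m) * X ^ m →
      (p : ℝ) ^ (1 / 2 + δ) ≤ (A.support.card : ℝ) + (B.support.card : ℝ)

/-! ## The refutation -/

/-- A primitive cube root of unity, `ω = (-1 + i√3)/2`. [folklore] -/
noncomputable def ω : ℂ := ⟨-1 / 2, Real.sqrt 3 / 2⟩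

/-- `|ω| = 1`. [folklore] -/
theorem norm_omega : ‖ω‖ = 1 := by
  have h3 : Real.sqrt 3 ^ 2 = 3 := Real.sq_sqrt (by norm_num)
  have h : ω.re ^ 2 + ω.im ^ 2 = 1 := by simp [ω]; nlinarith [h3]
  rw [Complex.norm_eq_sqrt_sq_add_sq, h, Real.sqrt_one]

/-- `|1 + ω| = 1` (as `1 + ω = -ω²`). [folklore] -/
theorem norm_one_add_omega : ‖1 + ω‖ = 1 := by
  have h3 : Real.sqrt 3 ^ 2 = 3 := Real.sq_sqrt (by norm_num)
  have h : (1 + ω).re ^ 2 + (1 + ω).im ^ 2 = 1 := by simp [ω]; nlinarith [h3]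
  rw [Complex.norm_eq_sqrt_sq_add_sq, h, Real.sqrt_one]

/-- The all-ones block `1 + X + ⋯ + X^{a-1}`. [folklore] -/
noncomputable def ones (a : ℕ) : ℂ[X] := ∑ i ∈ range a, X ^ i

/-- The dilated comb `Σ_{j<t} X^{a j}`. [folklore] -/
noncomputable def comb (a t : ℕ) : ℂ[X] := ∑ j ∈ range t, X ^ (a * j)

/-- Coefficients of the all-ones block. [folklore] -/
theorem coeff_ones (a m : ℕ) : (ones a).coeff m = if m < a then 1 else 0 := by
  simp [ones, finsetSum_coeff, coeff_X_pow]

/-- Splitting an all-ones block: `ones (k + a) = ones k + X^k · ones a`. [folklore] -/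
theorem ones_add (k a : ℕ) : ones (k + a) = ones k + X ^ k * ones a := by
  unfold ones
  rw [Finset.sum_range_add, Finset.mul_sum]
  simp [pow_add]

/-- Digit tiling: `(1 + X + ⋯ + X^{a-1})·Σ_{j<t} X^{aj} = 1 + X + ⋯ + X^{at-1}`. [folklore] -/
theorem ones_mul_comb (a t : ℕ) : ones a * comb a t = ones (a * t) := by
  induction t with
  | zero => simp [comb, ones]
  | succ t ih =>
    rw [comb, Finset.sum_range_succ, ← comb, mul_add, ih, Nat.mul_succ, ones_add]
    ring

/-- Subadditivity of the number of monomials. [folklore] -/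
theorem card_support_add_le (p q : ℂ[X]) :
    (p + q).support.card ≤ p.support.card + q.support.card :=
  (Finset.card_le_card support_add).trans (Finset.card_union_le _ _)

/-- A sum of `k` polynomials with at most one monomial each has at most `k` monomials. [folklore] -/
theorem card_support_sum_le_of_card_le_one (f : ℕ → ℂ[X]) (hf : ∀ i, (f i).support.card ≤ 1) (k : ℕ) :
    (∑ i ∈ range k, f i).support.card ≤ k := by
  induction k with
  | zero => simp
  | succ k ih =>
    rw [Finset.sum_range_succ]
    exact (card_support_add_le _ _).trans (by have := hf k; omega)

/-- `ones a` has at most `a` monomials. [folklore] -/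
theorem card_support_ones_le (a : ℕ) : (ones a).support.card ≤ a :=
  card_support_sum_le_of_card_le_one _ (fun i => by simp) a

/-- `comb a t` has at most `t` monomials. [folklore] -/
theorem card_support_comb_le (a t : ℕ) : (comb a t).support.card ≤ t :=
  card_support_sum_le_of_card_le_one _
    (fun j => by simp) t

/-- `deg (ones a) ≤ a - 1`. [folklore] -/
theorem natDegree_ones_le (a : ℕ) : (ones a).natDegree ≤ a - 1 := by
  unfold ones
  refine natDegree_sum_le_of_forall_le _ _ ?_
  intro i hi
  rw [Finset.mem_range] at hi
  rw [natDegree_X_pow]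
  omega

/-- The cofactor of `X·ones a` in the witness: `Q = ones a · (comb a t + ω X^{n-a})`. [folklore] -/
noncomputable def Qpoly (n a t : ℕ) : ℂ[X] := ones a * (comb a t + C ω * X ^ (n - a))

/-- `Q = ones (a t) + ω X^{n-a} ones a` (digit tiling plus patch). [folklore] -/
theorem Qpoly_eq (n a t : ℕ) : Qpoly n a t = ones (a * t) + C ω * (X ^ (n - a) * ones a) := by
  unfold Qpoly; rw [mul_add, ones_mul_comb]; ring

/-- Coefficients of `Q`: `[m < at] + ω·[n-a ≤ m < n]`. [folklore] -/
theorem coeff_Qpoly (n a t m : ℕ) (ha1 : 1 ≤ a) (ha : a ≤ n) :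
    (Qpoly n a t).coeff m = (if m < a * t then 1 else 0) + (if n - a ≤ m ∧ m < n then ω else 0) := by
  rw [Qpoly_eq, coeff_add, coeff_ones, coeff_C_mul, coeff_X_pow_mul', coeff_ones]
  have key : (m - (n - a) < a) ↔ m < n := by omega
  by_cases h1 : n - a ≤ m <;> by_cases h2 : m < n <;> simp [h1, h2, key]

/-- Every coefficient of `Q` below `n` is unimodular (`1`, `1+ω` or `ω`) provided `at ≤ n < at + a`. [folklore] -/
theorem norm_coeff_Qpoly (n a t m : ℕ) (ha1 : 1 ≤ a) (ha : a ≤ n) (ht : n < a * t + a) (hm : m < n) :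
    ‖(Qpoly n a t).coeff m‖ = 1 := by
  rw [coeff_Qpoly n a t m ha1 ha]
  by_cases h1 : m < a * t <;> by_cases h2 : n - a ≤ m
  · simp [h1, h2, hm, norm_one_add_omega]
  · simp [h1, h2]
  · simp [h1, h2, hm, norm_omega]
  · exfalso; omega

/-- `deg Q < n` when `1 ≤ a ≤ n` and `at ≤ n`. [folklore] -/
theorem natDegree_Qpoly_lt (n a t : ℕ) (ha1 : 1 ≤ a) (ha : a ≤ n) (ht : a * t ≤ n) :
    (Qpoly n a t).natDegree < n := by
  rw [Qpoly_eq]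
  have h1 : (ones (a * t)).natDegree ≤ a * t - 1 := natDegree_ones_le _
  have h2 : (C ω * (X ^ (n - a) * ones a)).natDegree ≤ (n - a) + (a - 1) := by
    refine (natDegree_C_mul_le _ _).trans ?_
    refine (natDegree_mul_le).trans ?_
    have := natDegree_ones_le a
    have hx : ((X : ℂ[X]) ^ (n - a)).natDegree = n - a := natDegree_X_pow _
    omega
  have := natDegree_add_le (ones (a * t)) (C ω * (X ^ (n - a) * ones a))
  have h3 : max (ones (a * t)).natDegree (C ω * (X ^ (n - a) * ones a)).natDegree < n := by
    rw [max_lt_iff]; constructor <;> omega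
  omega

/-- **`FeketeNoSparseSplitWithoutLegendre` is FALSE**: for every `δ > 0` and `p₀` there is a prime `p ≥ p₀`, a
unimodular `ε` and a splitting of `Σ_{0<m<p} ε(m) X^m` of support-sum `≤ 2√p + 2 < p^{1/2+δ}` (explicit digit
tiling with a cube-root-of-unity patch).  Consequently any proof of the crux `FeketeSOS.FeketeNoSparseSplit`
must use the VALUES of `χ_p`, not only `|χ_p(m)| = 1`, the support `[1, p-1]` and the primality of `p`. [folklore] -/
theorem not_feketeNoSparseSplitWithoutLegendre : ¬ FeketeNoSparseSplitWithoutLegendre := by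
  rintro ⟨δ, hδ, p₀, H⟩
  obtain ⟨p, hpN, hp⟩ := Nat.exists_infinite_primes (max p₀ (max 16 ⌈(4 : ℝ) ^ (1 / δ)⌉₊))
  haveI : Fact p.Prime := ⟨hp⟩
  have hp₀ : p₀ ≤ p := le_trans (le_max_left _ _) hpN
  have hp16 : 16 ≤ p := le_trans (le_trans (le_max_left _ _) (le_max_right _ _)) hpN
  have hpceil : ⌈(4 : ℝ) ^ (1 / δ)⌉₊ ≤ p := le_trans (le_trans (le_max_right _ _) (le_max_right _ _)) hpN
  -- parameters of the tiling
  obtain ⟨n, hn⟩ : ∃ n, p = n + 1 := ⟨p - 1, by omega⟩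
  set a := Nat.sqrt n + 1 with ha
  set t := n / a with ht
  have hn1 : 15 ≤ n := by omega
  have hsqrt_lt : Nat.sqrt n < n := Nat.sqrt_lt_self (by omega)
  have ha1 : 1 ≤ a := by omega
  have han : a ≤ n := by omega
  have hat : a * t ≤ n := Nat.mul_div_le n a
  have hnat : n < a * t + a := by
    have := Nat.lt_mul_div_succ n (show 0 < a by omega)
    simpa [ht, Nat.mul_succ] using this
  have ht_le : t ≤ Nat.sqrt n := by
    have h1 : n / a < Nat.sqrt n + 1 := by
      rw [Nat.div_lt_iff_lt_mul (by omega)]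
      have := Nat.lt_succ_sqrt' n
      simpa [ha, pow_two] using this
    omega
  -- the witness
  set Q := Qpoly n a t with hQ
  let ε : ℕ → ℂ := fun m => if m ≤ n then Q.coeff (m - 1) else 1
  have hε : ∀ m, ‖ε m‖ = 1 := by
    intro m
    simp only [ε]
    split_ifs with hm
    · exact norm_coeff_Qpoly n a t (m - 1) ha1 han hnat (by omega)
    · simp
  have hQsum : Q = ∑ i ∈ range n, C (Q.coeff i) * X ^ i := by
    conv_lhs => rw [as_sum_range' Q n (natDegree_Qpoly_lt n a t ha1 han hat)]
    simp only [C_mul_X_pow_eq_monomial]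
  have hAB : (X * ones a) * (comb a t + C ω * X ^ (n - a)) =
      ∑ m ∈ Finset.range p, C (if m = 0 then 0 else ε m) * X ^ m := by
    have hXQ : (X * ones a) * (comb a t + C ω * X ^ (n - a)) = X * Q := by
      rw [hQ, Qpoly, mul_assoc]
    rw [hXQ, hn, Finset.sum_range_succ']
    simp only [Nat.succ_ne_zero, if_false, if_true, map_zero, zero_mul, add_zero]
    conv_lhs => rw [hQsum]
    rw [Finset.mul_sum]
    refine Finset.sum_congr rfl ?_
    intro i hi
    rw [Finset.mem_range] at hi
    have hεi : ε (i + 1) = Q.coeff i := by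
      simp only [ε]
      rw [if_pos (by omega), Nat.add_sub_cancel]
    rw [hεi]
    ring
  -- support sizes
  have hA : (X * ones a).support.card ≤ a := by
    refine (card_support_mul_le).trans ?_
    rw [support_X, Finset.card_singleton, one_mul]
    exact card_support_ones_le a
  have hB : (comb a t + C ω * X ^ (n - a)).support.card ≤ t + 1 :=
    (card_support_add_le _ _).trans (add_le_add (card_support_comb_le a t) card_support_C_mul_X_pow_le_one)
  have hsum : (X * ones a).support.card + (comb a t + C ω * X ^ (n - a)).support.card
      ≤ 2 * Nat.sqrt n + 2 := by omega
  -- the claimed lower bound fails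
  have hbound := H p hp₀ ε hε (X * ones a) (comb a t + C ω * X ^ (n - a)) hAB
  have hreal : ((X * ones a).support.card : ℝ) + ((comb a t + C ω * X ^ (n - a)).support.card : ℝ)
      ≤ 2 * (Nat.sqrt n : ℝ) + 2 := by exact_mod_cast hsum
  have hppos : (0 : ℝ) < p := by exact_mod_cast hp.pos
  have hsq : (Nat.sqrt n : ℝ) ≤ Real.sqrt p := by
    have h1 : ((Nat.sqrt n : ℝ)) ^ 2 ≤ (p : ℝ) := by
      have := Nat.sqrt_le' n
      have h' : (Nat.sqrt n) ^ 2 ≤ p := by omega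
      exact_mod_cast h'
    calc (Nat.sqrt n : ℝ) = Real.sqrt (((Nat.sqrt n : ℝ)) ^ 2) := by
          rw [Real.sqrt_sq (by positivity)]
      _ ≤ Real.sqrt p := Real.sqrt_le_sqrt h1
  have h4 : (4 : ℝ) ≤ (p : ℝ) ^ δ := by
    have hc : (4 : ℝ) ^ (1 / δ) ≤ p := le_trans (Nat.le_ceil _) (by exact_mod_cast hpceil)
    have h := Real.rpow_le_rpow (by positivity) hc hδ.le
    rwa [← Real.rpow_mul (by norm_num), one_div_mul_cancel hδ.ne', Real.rpow_one] at h
  have hsplit : (p : ℝ) ^ (1 / 2 + δ) = Real.sqrt p * (p : ℝ) ^ δ := by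
    rw [Real.rpow_add hppos, Real.sqrt_eq_rpow]
  have hone : (1 : ℝ) < Real.sqrt p := by
    have h := Real.sqrt_lt_sqrt (by norm_num) (show (1 : ℝ) < p by exact_mod_cast (by omega : 1 < p))
    simpa using h
  have hge : 4 * Real.sqrt p ≤ (p : ℝ) ^ (1 / 2 + δ) := by
    rw [hsplit]
    nlinarith [Real.sqrt_nonneg (p : ℝ), h4]
  linarith

/-! ## The true counterpart: the counting exponent is exactly `1/2`

What survives of the refuted claim once `0 < δ` is dropped: for EVERY `p ≥ 2` (prime or not) and every
nowhere-vanishing — in particular unimodular — sequence `ε`, a splitting `A·B = Σ_{0<m<p} ε(m) X^m` has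
`p - 1 = |supp (A·B)| ≤ |supp A|·|supp B|` (as `supp (A·B) ⊆ supp A + supp B`), hence
`|supp A| + |supp B| ≥ 2√(p-1) ≥ p^{1/2}`.  Together with `not_feketeNoSparseSplitWithoutLegendre` (support-sum
`≤ 2√p + 2` is attained at every prime) this pins the exponent of the unimodular family to exactly `1/2`: the
clause `0 < δ` is precisely what fails.  Proved outright; nothing here is a named fact. -/

/-- Coefficients of the unimodular model `Σ_{m<p} [m ≠ 0]·ε(m)·X^m`: `ε(m)` for `0 < m < p`, else `0`. [folklore] -/
theorem coeff_unimodularModel (p : ℕ) (ε : ℕ → ℂ) (m : ℕ) :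
    (∑ k ∈ Finset.range p, C (if k = 0 then 0 else ε k) * X ^ k).coeff m =
      if m < p then (if m = 0 then 0 else ε m) else 0 := by
  simp only [finsetSum_coeff, coeff_C_mul_X_pow]
  simp [Finset.mem_range]

/-- **Counting bound (product form).** If `A·B = Σ_{0<m<p} ε(m) X^m` with every `ε(m) ≠ 0`, then
`p - 1 ≤ |supp A|·|supp B|`: the right-hand side has exactly the `p - 1` monomials `X, …, X^{p-1}`, and
`supp (A·B) ⊆ supp A + supp B` (Mathlib's `Polynomial.card_support_mul_le`). [folklore] -/
theorem sub_one_le_card_support_mul_card_support (p : ℕ) (ε : ℕ → ℂ) (hε : ∀ m, ε m ≠ 0) (A B : ℂ[X])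
    (h : A * B = ∑ m ∈ Finset.range p, C (if m = 0 then 0 else ε m) * X ^ m) :
    p - 1 ≤ A.support.card * B.support.card := by
  have hsupp : (Finset.range p).erase 0 ⊆ (A * B).support := by
    intro m hm
    rw [Finset.mem_erase, Finset.mem_range] at hm
    rw [mem_support_iff, h, coeff_unimodularModel, if_pos hm.2, if_neg hm.1]
    exact hε m
  have hcard : ((Finset.range p).erase 0).card = p - 1 := by
    rcases Nat.eq_zero_or_pos p with rfl | hp
    · simp
    · rw [Finset.card_erase_of_mem (Finset.mem_range.mpr hp), Finset.card_range]
  calc p - 1 = ((Finset.range p).erase 0).card := hcard.symm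
    _ ≤ (A * B).support.card := Finset.card_le_card hsupp
    _ ≤ A.support.card * B.support.card := card_support_mul_le

/-- **Counting bound (sum form): `2√(p-1) ≤ |supp A| + |supp B|`** for every splitting
`A·B = Σ_{0<m<p} ε(m) X^m` with `ε` nowhere zero (AM–GM on the product form). [folklore] -/
theorem two_mul_sqrt_le_card_support_add (p : ℕ) (ε : ℕ → ℂ) (hε : ∀ m, ε m ≠ 0) (A B : ℂ[X])
    (h : A * B = ∑ m ∈ Finset.range p, C (if m = 0 then 0 else ε m) * X ^ m) :
    2 * Real.sqrt ((p : ℝ) - 1) ≤ (A.support.card : ℝ) + (B.support.card : ℝ) := by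
  have hnat := sub_one_le_card_support_mul_card_support p ε hε A B h
  set a := A.support.card
  set b := B.support.card
  have hab : (p : ℝ) - 1 ≤ (a : ℝ) * (b : ℝ) := by
    have h1 : ((p - 1 : ℕ) : ℝ) ≤ ((a * b : ℕ) : ℝ) := by exact_mod_cast hnat
    have h2 : (p : ℝ) - 1 ≤ ((p - 1 : ℕ) : ℝ) := by
      rcases Nat.eq_zero_or_pos p with rfl | hp
      · simp
      · rw [Nat.cast_sub hp]; simp
    have h3 : ((a * b : ℕ) : ℝ) = (a : ℝ) * (b : ℝ) := by push_cast; ring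
    linarith
  have hnn : (0 : ℝ) ≤ (a : ℝ) + b := by positivity
  have hsq : 4 * ((p : ℝ) - 1) ≤ ((a : ℝ) + b) ^ 2 := by nlinarith [sq_nonneg ((a : ℝ) - b)]
  have h4 : Real.sqrt 4 = 2 := by
    rw [show (4 : ℝ) = 2 ^ 2 by norm_num, Real.sqrt_sq (by norm_num)]
  calc 2 * Real.sqrt ((p : ℝ) - 1) = Real.sqrt (4 * ((p : ℝ) - 1)) := by
        rw [Real.sqrt_mul (by norm_num : (0 : ℝ) ≤ 4), h4]
    _ ≤ Real.sqrt (((a : ℝ) + b) ^ 2) := Real.sqrt_le_sqrt hsq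
    _ = (a : ℝ) + b := Real.sqrt_sq hnn

/-- **`FeketeNoSparseSplitWithoutLegendre` at the endpoint `δ = 0` is TRUE**, for every `p ≥ 2` (prime or
not) and every unimodular `ε`: `p^{1/2} ≤ |supp A| + |supp B|` (from `2√(p-1)` and `4(p-1) ≥ p`).  With
`not_feketeNoSparseSplitWithoutLegendre`, the exponent of the unimodular family is exactly `1/2`. [folklore] -/
theorem feketeNoSparseSplitWithoutLegendre_delta_zero (p : ℕ) (hp : 2 ≤ p) (ε : ℕ → ℂ)
    (hε : ∀ m, ‖ε m‖ = 1) (A B : ℂ[X])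
    (h : A * B = ∑ m ∈ Finset.range p, C (if m = 0 then 0 else ε m) * X ^ m) :
    (p : ℝ) ^ (1 / 2 : ℝ) ≤ (A.support.card : ℝ) + (B.support.card : ℝ) := by
  have hε' : ∀ m, ε m ≠ 0 := fun m h0 => by simpa [h0] using hε m
  have hnat := sub_one_le_card_support_mul_card_support p ε hε' A B h
  set a := A.support.card
  set b := B.support.card
  have hab : (p : ℝ) - 1 ≤ (a : ℝ) * (b : ℝ) := by
    have h1 : ((p - 1 : ℕ) : ℝ) ≤ ((a * b : ℕ) : ℝ) := by exact_mod_cast hnat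
    have h2 : ((p - 1 : ℕ) : ℝ) = (p : ℝ) - 1 := by
      rw [Nat.cast_sub (by omega : 1 ≤ p)]; simp
    have h3 : ((a * b : ℕ) : ℝ) = (a : ℝ) * (b : ℝ) := by push_cast; ring
    linarith
  have hp2 : (2 : ℝ) ≤ p := by exact_mod_cast hp
  have hnn : (0 : ℝ) ≤ (a : ℝ) + b := by positivity
  have hsq : (p : ℝ) ≤ ((a : ℝ) + b) ^ 2 := by nlinarith [sq_nonneg ((a : ℝ) - b)]
  calc (p : ℝ) ^ (1 / 2 : ℝ) = Real.sqrt p := by rw [Real.sqrt_eq_rpow]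
    _ ≤ Real.sqrt (((a : ℝ) + b) ^ 2) := Real.sqrt_le_sqrt hsq
    _ = (a : ℝ) + b := Real.sqrt_sq hnn

/-- **The refuted family with `0 < δ` deleted holds** (same quantifier shape as
`FeketeNoSparseSplitWithoutLegendre`, exponent `1/2 + 0`, threshold `p₀ = 2`): so the clause `0 < δ` is exactly
the load-bearing — and false — part of the refuted variant. [folklore] -/
theorem feketeNoSparseSplitWithoutLegendre_endpoint :
    ∃ p₀ : ℕ, ∀ (p : ℕ) [Fact p.Prime], p₀ ≤ p → ∀ (ε : ℕ → ℂ), (∀ m, ‖ε m‖ = 1) →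
      ∀ (A B : Polynomial ℂ), A * B = ∑ m ∈ Finset.range p, C (if m = 0 then 0 else ε m) * X ^ m →
        (p : ℝ) ^ (1 / 2 + 0 : ℝ) ≤ (A.support.card : ℝ) + (B.support.card : ℝ) := by
  refine ⟨2, fun p _ hp ε hε A B h => ?_⟩
  rw [add_zero]
  exact feketeNoSparseSplitWithoutLegendre_delta_zero p hp ε hε A B h


end Literature.Barriers.ValiantsHypothesis
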